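import Summits.CriticalPhenomena.CardyFormulaZ2.Theses.CardyMagicRigidity
import Literature.Probability.Percolation.CardyFormulaConformalInvariance
import Literature.Probability.Percolation.AnnulusCrossingBound
import Literature.Probability.RandomPlanarGeometry.ConformalRectangleProofs
import Literature.Probability.RandomPlanarGeometry.CardyFunctionIncBeta
import Literature.Probability.RandomPlanarGeometry.RadoConvergence

/-!
# Skeleton line `br-sandwich-diagonal` for crux `LoopsToCrossings` (stmt-CriticalPhenomena-4837)

Route `CardyMagicRigidity`, crux r5 `LoopsToCrossings = X → ∀ R, bond R δ − tri R δ → 0`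
(`X = LoopLimitZ2EqT`, G02 events on `δℤ²` / `δ𝕋`).  Planner `crux-plan`, idea card
`Ideas/br-sandwich-diagonal.md` (ideator 1, r1; triage r1: 3 × pass, "same lever as
oracle-sandwich / cardy-sandwich-rado-chart: Smirnov-on-𝕋-for-every-R + deterministic BR sandwich
ported to ℤ² + continuity of the Cardy value of the comparison domains ⇒ the crux reduces to
ONE-SIDED transfers WITH ROOM between nice quads").

## The line

Comparison family = the COLLAR RECTANGLES of the tree (`MarkedDomain.collarRect`,
`CollarDomain.lean`; Bollobás–Riordan Ch. 7 p. 186 / Fig. 14): for tube data `T` of `R`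
(`JordanDomain.nonempty_tubeData`, two-sided Carathéodory charts, PROVED) and a width `h`,
`C⁻_h := R.collarRect T σm h` is `∂Ω` pushed OUT along arcs 0, 2 and IN along arcs 1, 3 through
the four corners ("longer–thinner", harder to cross from arc 0 to arc 2) and `C⁺_h := R.collarRect
T σp h` the reverse ("shorter–fatter", easier).  Along each sign family the width is a ROOM
parameter: `C⁻_{h'}` is longer–thinner than `C⁻_h` and `C⁺_{h'}` shorter–fatter than `C⁺_h` for
`h < h'`, and `R` sits between the two families.  The crux for `R` is squeezed through the chain

  `bond R ≤ bond C⁺_h + ε ≤ tri C⁺_{h'} + 2ε → F(η(C⁺_{h'})) + 2ε ≤ F(η_R) + 3ε`,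
  `bond R ≥ bond C⁻_h − ε ≥ tri C⁻_{h'} − 2ε → F(η(C⁻_{h'})) − 2ε ≥ F(η_R) − 3ε`,

whose four ingredients are the stubs:
* `stub_sandwichLowerZ2`, `stub_sandwichUpperZ2` (L, X-free, single lattice ℤ²): Bollobás–Riordan's
  sandwich (19) — Claim 19 (deterministic topology, p. 192) + Claim 20 (four corner one-arm events,
  Lemma 4) — PORTED from `triCrossing` (tree: `TriCrossingSandwich.lean`, `mem_triCrossing_of_pathIn`,
  `level_m` / `level_p`) to G02's bond event `discreteCrossing` between `R` and its collar
  rectangles; inputs all proved on ℤ²: bulk lemma `JordanDomain.exists_forall_mem_meshDomain_and_reachable`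
  (every Jordan domain), `annulusOpenCrossing_half_le_holds` (corner one-arm), collar geometry
  (`tube_mem_collarRect`, `exists_eq_tube_of_mem_of_not_mem_closure`, `arc_close`).  THIS is where
  the wild boundary of `R` is disposed of, on one lattice, with no arm exponent beyond one-arm.
* `stub_collarModulus` (M, X-free, analysis): the conformal modulus of `R.collarRect T σ h` tends to
  that of `R` as `h → 0⁺` (uniformly over uniformizing data).  Source: Radó's theorem, PROVED in the
  tree (`JordanDomain.rado_tendstoUniformlyOn_holds`, `RadoConvergenceProofs.lean`): the collar
  loops converge uniformly to `∂Ω` (`dist_collarLoop_lt`), so the normalised Carathéodory charts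
  converge on the closed disc, the preimages of the four FIXED corners converge, and the cross-ratio
  is continuous.  (The card's "slow diagonal" (D) is NOT used — triage r1-1/2/3 sharpen answered.)
* `stub_roomTransferUpper`, `stub_roomTransferLower` (XL, use `X`, two lattices, LOAD-BEARING
  residual = the slot for a core engine: mono-polarisation-trace-duality / quad-implant-separation /
  cluster-shadowing with 4-sided room): a bond crossing of `C⁺_h` forces, under the couplings of
  `X`, a site-𝕋 crossing of the shorter–fatter `C⁺_{h'}` up to `ε` (and a site-𝕋 crossing of the
  longer–thinner `C⁻_{h'}` forces a bond crossing of `C⁻_h`): one-sided, WITH ROOM `h' − h > 0` in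
  the tube coordinate off the corners (corners: one-arm on each lattice), between two collar
  rectangles — never the wild `R`, never a same-domain comparison.
`LoopsToCrossings_of` composes the five stubs with Smirnov's theorem on `𝕋` for the collar
rectangles (`hasCrossingLimit_triDomainCrossingProb_holds`, PROVED), existence of uniformizing data
(`MarkedDomain.exists_isUniformizing_holds`) and uniform continuity of `F` on `[0,1]`
(`continuousOn_cardyFunction_holds` + Heine–Cantor): kernel-checked, no `sorry`.

## Disproof used (`Cruxes/LoopsToCrossings/Disproof.lean`, cdisprove gen 2, rc 0)
* §1 `loopsToCrossings_iff` (crux ≡ X → Cardy-on-ℤ² given Smirnov-∀R): the composition is exactly a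
  proof of `bond R → F(η_R)`; §2: no `_false_without_X` exists — `X` is consumed only by the two
  `stub_roomTransfer*` (the core), the other three stubs are X-free facts about one lattice / no lattice.
* §4 BARRIER `hits_not_isClose_robust` (crossing events are not d_CN-robust): honoured — the only
  cross-lattice statements (`stub_roomTransfer*`) compare a quad with a STRICTLY EASED quad
  (room `h' − h > 0`), the robust direction `IsClose.hits_cthickening_of_hits`.
* §5 `sandwich_transfer` template: each `stub_roomTransfer*` is ONE half of it (one inner/outer pair).
* §6 `not_uniformCrossingUniversality`: every stub is per rectangle (`∀ R`, thresholds depend on `R, T`).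
* §3 `clusterPt_sub_mem_Ioo` / negatives index stmt-0748: consistent (no degenerate arcs claimed).
No `Negative/` lemma has landed for this crux (nothing to import); none of the 8 entries of
`ledger negatives --problem CriticalPhenomena` is an instance of a stub.
-/

noncomputable section

open Set Filter Topology Metric
open UpperHalfPlane (upperHalfPlaneSet)
open Literature.Probability.RandomPlanarGeometry
open Literature.Probability.Percolation (bondDomainCrossingProb triDomainCrossingProb
  hasCrossingLimit_triDomainCrossingProb_holds σm σp σm_sign σp_sign)
open Summit.CriticalPhenomena.CardyFormulaZ2.Theses.CardyMagicRigidity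

namespace Summit.CriticalPhenomena.CardyFormulaZ2.Cruxes.LoopsToCrossings.BrSandwichDiagonal

/-! ### The five statements of the line

Each statement is a precise `Prop`, restated verbatim by its registered `theorem stub_… := by sorry` below (the
only `sorry`s of the file) and aliased under the stub's short name in the implementation-detail namespace
`__Registered` (the hypotheses of `LoopsToCrossings_of`, admissible BY NAME for the native skeleton audit);
`loopsToCrossings_proof` applies the composition to the five `stub_…` literally, which checks that statements,
aliases and stubs agree.  (The audit's stub attribute is gate-reserved and is not written by a planner.) -/

/-- STATEMENT A — Bollobás–Riordan sandwich on `ℤ²`, lower half: for every width bound `h₀` there is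
a width `h ≤ h₀` such that eventually in `δ` the bond crossing probability of the longer–thinner
collar rectangle `C⁻_h = R.collarRect T σm h` is at most that of `R` plus `ε`. -/
def SandwichLowerZ2 : Prop :=
  ∀ (R : ConformalRectangle) (T : R.toJordanDomain.TubeData) (ε : ℝ), 0 < ε → ∀ h₀ : ℝ, 0 < h₀ →
    ∃ (h : ℝ) (hh : 0 < h) (hh1 : h ≤ 1 / 2), h ≤ h₀ ∧
      ∀ᶠ δ : ℝ in 𝓝[>] 0,
        bondDomainCrossingProb (R.collarRect T (MarkedDomain.abs_le_one_of_sign σm_sign) hh hh1) δ ≤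
          bondDomainCrossingProb R δ + ε

/-- STATEMENT B — Bollobás–Riordan sandwich on `ℤ²`, upper half: the bond crossing probability of
`R` is eventually at most that of the shorter–fatter collar rectangle `C⁺_h = R.collarRect T σp h`
plus `ε`, for some width `h` below any prescribed bound. -/
def SandwichUpperZ2 : Prop :=
  ∀ (R : ConformalRectangle) (T : R.toJordanDomain.TubeData) (ε : ℝ), 0 < ε → ∀ h₀ : ℝ, 0 < h₀ →
    ∃ (h : ℝ) (hh : 0 < h) (hh1 : h ≤ 1 / 2), h ≤ h₀ ∧
      ∀ᶠ δ : ℝ in 𝓝[>] 0,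
        bondDomainCrossingProb R δ ≤
          bondDomainCrossingProb (R.collarRect T (MarkedDomain.abs_le_one_of_sign σp_sign) hh hh1) δ + ε

/-- STATEMENT C — continuity of the conformal modulus of collar rectangles at width `0`: for every
sign pattern `σ` and every uniformizing datum `(φ, x)` of `R`, the cross-ratio of EVERY
uniformizing datum of `R.collarRect T σ h` is within `ε` of `crossRatio x` once `h ≤ h₀(ε)`. -/
def CollarModulus : Prop :=
  ∀ (R : ConformalRectangle) (T : R.toJordanDomain.TubeData) (σ : Fin 4 → ℝ) (hσ : ∀ i, |σ i| ≤ 1)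
    (φ : ConformalEquiv upperHalfPlaneSet R.carrier) (x : Fin 4 → ℝ), R.IsUniformizing φ x →
    ∀ ε : ℝ, 0 < ε → ∃ h₀ : ℝ, 0 < h₀ ∧ ∀ (h : ℝ) (hh : 0 < h) (hh1 : h ≤ 1 / 2), h ≤ h₀ →
      ∀ (φ' : ConformalEquiv upperHalfPlaneSet (R.collarRect T hσ hh hh1).carrier) (x' : Fin 4 → ℝ),
        (R.collarRect T hσ hh hh1).IsUniformizing φ' x' → |crossRatio x' - crossRatio x| ≤ ε

/-- STATEMENT D — one-sided transfer WITH ROOM, `ℤ² → 𝕋`, along the shorter–fatter family: under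
`X`, below a threshold `h₁(R, T)`, a bond crossing of `C⁺_h` forces (up to `ε`, eventually in `δ`)
a site-`𝕋` crossing of the strictly shorter–fatter `C⁺_{h'}`, `h < h'`. -/
def RoomTransferUpper : Prop :=
  LoopLimitZ2EqT → ∀ (R : ConformalRectangle) (T : R.toJordanDomain.TubeData), ∃ h₁ : ℝ, 0 < h₁ ∧
    ∀ (h h' : ℝ) (hh : 0 < h) (hh' : 0 < h') (hh1 : h ≤ 1 / 2) (hh'1 : h' ≤ 1 / 2), h < h' → h' ≤ h₁ →
      ∀ ε : ℝ, 0 < ε → ∀ᶠ δ : ℝ in 𝓝[>] 0,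
        bondDomainCrossingProb (R.collarRect T (MarkedDomain.abs_le_one_of_sign σp_sign) hh hh1) δ ≤
          triDomainCrossingProb (R.collarRect T (MarkedDomain.abs_le_one_of_sign σp_sign) hh' hh'1) δ + ε

/-- STATEMENT E — one-sided transfer WITH ROOM, `𝕋 → ℤ²`, along the longer–thinner family: under
`X`, below a threshold `h₁(R, T)`, a site-`𝕋` crossing of `C⁻_{h'}` forces (up to `ε`, eventually
in `δ`) a bond crossing of the strictly shorter–fatter `C⁻_h`, `h < h'`. -/
def RoomTransferLower : Prop :=
  LoopLimitZ2EqT → ∀ (R : ConformalRectangle) (T : R.toJordanDomain.TubeData), ∃ h₁ : ℝ, 0 < h₁ ∧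
    ∀ (h h' : ℝ) (hh : 0 < h) (hh' : 0 < h') (hh1 : h ≤ 1 / 2) (hh'1 : h' ≤ 1 / 2), h < h' → h' ≤ h₁ →
      ∀ ε : ℝ, 0 < ε → ∀ᶠ δ : ℝ in 𝓝[>] 0,
        triDomainCrossingProb (R.collarRect T (MarkedDomain.abs_le_one_of_sign σm_sign) hh' hh'1) δ ≤
          bondDomainCrossingProb (R.collarRect T (MarkedDomain.abs_le_one_of_sign σm_sign) hh hh1) δ + ε

/-! ### The registered stubs `stub_…` (the only `sorry`s of the file) -/

/-- STUB A (L, X-free, ℤ² only) — `SandwichLowerZ2`: Bollobás–Riordan (19) lower half for G02's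
bond event, `P_δ(C⁻_h) ≤ P_δ(R) + ε` eventually, `C⁻_h` the longer–thinner collar rectangle of a
width `h` below any prescribed bound.  Why plausible: Claim 19 (p. 192) is deterministic — a G02
crossing of `(C⁻_h)_δ` from its discrete arc 0 to its discrete arc 2 that stays `ρ`-away from the
corners starts outside `closure Ω` near `arc 0`, ends outside near `arc 2`, and its inside sites keep
off `arc 1 ∪ arc 3` (collar pushed in there), so the ℤ² twin of `mem_triCrossing_of_pathIn` (bulk:
`JordanDomain.exists_forall_mem_meshDomain_and_reachable`, every Jordan domain) extracts a crossing
of `Ω_δ`; Claim 20: otherwise one of the four corner annuli `A(Pᵢ; ρ, r₂)` is crossed by the open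
path, probability `≤ 4(ρ/r₂)^α ≤ ε` by `annulusOpenCrossing_half_le_holds`.  The 𝕋 twin with a
discrete comparison domain is `level_m` (`TriCollarSandwichLevel.lean`). -/
theorem stub_sandwichLowerZ2 :
    ∀ (R : ConformalRectangle) (T : R.toJordanDomain.TubeData) (ε : ℝ), 0 < ε → ∀ h₀ : ℝ, 0 < h₀ →
      ∃ (h : ℝ) (hh : 0 < h) (hh1 : h ≤ 1 / 2), h ≤ h₀ ∧
        ∀ᶠ δ : ℝ in 𝓝[>] 0,
          bondDomainCrossingProb (R.collarRect T (MarkedDomain.abs_le_one_of_sign σm_sign) hh hh1) δ ≤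
            bondDomainCrossingProb R δ + ε := by
  sorry

/-- STUB B (L, X-free, ℤ² only) — `SandwichUpperZ2`: Bollobás–Riordan (19) upper half for G02's bond
event, `P_δ(R) ≤ P_δ(C⁺_h) + ε` eventually, `C⁺_h` the shorter–fatter collar rectangle.  Why
plausible: the same Claim 19/20 with the roles `(source, target) = (R, C⁺_h)` — `R` IS the
longer–thinner partner of `C⁺_h` — so a G02 crossing of `Ω_δ` staying `ρ`-off the corners has its
outside-`C⁺_h` sites within the collar width of arcs 0, 2 of `C⁺_h` (`exists_eq_tube_of_mem_of_mem`,
`tube_not_mem_collarRect`) and its inside sites off the pushed-out arcs 1, 3 of `C⁺_h`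
(`exists_le_infDist_tube_outer`), hence gives a G02 crossing of `(C⁺_h)_δ` by the ℤ² twin of
`mem_triCrossing_of_pathIn` applied to the conformal rectangle `C⁺_h` (its `t₀` is `dist(arc 0,
arc 2)/8`, bounded below along the family); corners as in STUB A.  No Lemma-5 duality is needed on
ℤ² because both events are G02 events of conformal rectangles. -/
theorem stub_sandwichUpperZ2 :
    ∀ (R : ConformalRectangle) (T : R.toJordanDomain.TubeData) (ε : ℝ), 0 < ε → ∀ h₀ : ℝ, 0 < h₀ →
      ∃ (h : ℝ) (hh : 0 < h) (hh1 : h ≤ 1 / 2), h ≤ h₀ ∧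
        ∀ᶠ δ : ℝ in 𝓝[>] 0,
          bondDomainCrossingProb R δ ≤
            bondDomainCrossingProb (R.collarRect T (MarkedDomain.abs_le_one_of_sign σp_sign) hh hh1) δ + ε := by
  sorry

/-- STUB C (M, X-free, pure complex analysis) — `CollarModulus`: the conformal modulus of the collar
rectangle `R.collarRect T σ h` converges to that of `R` as `h → 0⁺`, uniformly over the uniformizing
data.  Why plausible (indeed provable now): the collar loops `t ↦ tube (profile t) t` converge to
`∂Ω` UNIFORMLY as parametrised loops (`MarkedDomain.dist_collarLoop_lt` + `TubeData.exists_dist_tube_lt`),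
the corners are the SAME four points (`collarRect_pt`) and the centre `z₀` lies in every thin collar
domain (`z₀_mem_collarRect`); Radó's theorem — PROVED in the tree, `JordanDomain.rado_tendstoUniformlyOn_holds`
with the closed-disc form `rado_tendstoUniformlyOn.closedBall` — gives uniform convergence on `𝔻̄`
of the `z₀`-normalised Carathéodory charts, hence convergence of the preimages of the four corners
(injectivity of the limit chart on `𝔻̄`), hence of the cross-ratio after a fixed Cayley map
(`exists_isUniformizing_of_disc` pattern); independence of the datum is
`ConformalRectangle.crossRatio_eq_of_isUniformizing_holds`.  Replaces the card's "slow diagonal". -/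
theorem stub_collarModulus :
    ∀ (R : ConformalRectangle) (T : R.toJordanDomain.TubeData) (σ : Fin 4 → ℝ) (hσ : ∀ i, |σ i| ≤ 1)
      (φ : ConformalEquiv upperHalfPlaneSet R.carrier) (x : Fin 4 → ℝ), R.IsUniformizing φ x →
      ∀ ε : ℝ, 0 < ε → ∃ h₀ : ℝ, 0 < h₀ ∧ ∀ (h : ℝ) (hh : 0 < h) (hh1 : h ≤ 1 / 2), h ≤ h₀ →
        ∀ (φ' : ConformalEquiv upperHalfPlaneSet (R.collarRect T hσ hh hh1).carrier) (x' : Fin 4 → ℝ),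
          (R.collarRect T hσ hh hh1).IsUniformizing φ' x' → |crossRatio x' - crossRatio x| ≤ ε := by
  sorry

/-- STUB D (XL, LOAD-BEARING, uses `X`) — `RoomTransferUpper`: under full-plane loop universality
`X`, a bond-`ℤ²` G02 crossing of the collar rectangle `C⁺_h` forces, with probability `≥ 1 − ε`
eventually in `δ`, a site-`𝕋` G02 crossing of the strictly shorter–fatter `C⁺_{h'}` (`h < h' ≤ h₁`).
Why plausible: this is ONE half of the sandwich template `Disproof.sandwich_transfer` with ROOM —
couple the two percolations by `X` (`LoopConfig.exists_coupling_of_cnLawEDist_lt`) so that inside a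
window containing `closure Ω` every interface loop has a same-type partner at `udist ≤ η ≪ room`;
a bond crossing of `C⁺_h` is witnessed by a macroscopic interface-loop ARC separating the two
lateral sides inside the quad (trace duality / two-point separation / cluster shadow — the core
engines of the sibling cards), the partner arc on `𝕋` realises the same separation in the
`η`-fattened quad, which the room `h' − h` absorbs into a crossing of `C⁺_{h'}`
(`IsClose.hits_cthickening_of_hits` is the robust direction of Disproof §4); corners (where the
room vanishes) cost four one-arm events on each lattice (`annulusOpenCrossing_half_le_holds`,
`tri_annulusCrossing_bound_holds`); landing in G02's `triCrossing` of `C⁺_{h'}` is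
`mem_triCrossing_of_pathIn` (every Jordan domain, PROVED).  No boundary 3-arm exponent is needed
because source and target never share a boundary arc off the corners. -/
theorem stub_roomTransferUpper :
    LoopLimitZ2EqT → ∀ (R : ConformalRectangle) (T : R.toJordanDomain.TubeData), ∃ h₁ : ℝ, 0 < h₁ ∧
      ∀ (h h' : ℝ) (hh : 0 < h) (hh' : 0 < h') (hh1 : h ≤ 1 / 2) (hh'1 : h' ≤ 1 / 2), h < h' → h' ≤ h₁ →
        ∀ ε : ℝ, 0 < ε → ∀ᶠ δ : ℝ in 𝓝[>] 0,
          bondDomainCrossingProb (R.collarRect T (MarkedDomain.abs_le_one_of_sign σp_sign) hh hh1) δ ≤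
            triDomainCrossingProb (R.collarRect T (MarkedDomain.abs_le_one_of_sign σp_sign) hh' hh'1) δ + ε := by
  sorry

/-- STUB E (XL, LOAD-BEARING, uses `X`) — `RoomTransferLower`: under `X`, a site-`𝕋` G02 crossing of
the longer–thinner collar rectangle `C⁻_{h'}` forces, with probability `≥ 1 − ε` eventually in `δ`,
a bond-`ℤ²` G02 crossing of the strictly shorter–fatter `C⁻_h` (`h < h' ≤ h₁`).  Why plausible: the
same mechanism as STUB D with the lattices exchanged (`LoopConfig.IsClose` is symmetric and every
input — RSW window confinement, one-arm corner bounds, bulk lemma, `pathIn → G02` — is proved on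
both lattices: `mem_discreteCrossing_of_chain` / `exists_forall_mem_meshDomain_and_reachable` on ℤ²).
Kept separate from STUB D because a derivation by duality would need G02-duality for Jordan domains
on ℤ², which the tree has only for rectangles (`lrCrossing_xor_dualTBCrossing`). -/
theorem stub_roomTransferLower :
    LoopLimitZ2EqT → ∀ (R : ConformalRectangle) (T : R.toJordanDomain.TubeData), ∃ h₁ : ℝ, 0 < h₁ ∧
      ∀ (h h' : ℝ) (hh : 0 < h) (hh' : 0 < h') (hh1 : h ≤ 1 / 2) (hh'1 : h' ≤ 1 / 2), h < h' → h' ≤ h₁ →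
        ∀ ε : ℝ, 0 < ε → ∀ᶠ δ : ℝ in 𝓝[>] 0,
          triDomainCrossingProb (R.collarRect T (MarkedDomain.abs_le_one_of_sign σm_sign) hh' hh'1) δ ≤
            bondDomainCrossingProb (R.collarRect T (MarkedDomain.abs_le_one_of_sign σm_sign) hh hh1) δ + ε := by
  sorry

/-! ### Name-keyed aliases of the five statements (the hypotheses of the composition)

`__Registered.stub_X` is statement `X` under the registered stub's short name, so that the native skeleton audit
(`#h21_check_skeleton`: hypotheses admissible iff registered obligations / declared stubs BY NAME) accepts
`LoopsToCrossings_of : __Registered.stub_… → … → LoopsToCrossings` (device of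
`Cruxes/LagHandOff/Lines/crosscut-dictionary.lean`; the namespace is an implementation detail, so the audit's stub
report resolves each `stub_…` to the sorried theorem, not to its alias). -/
namespace __Registered

/-- Alias of `SandwichLowerZ2` keyed by the registered stub name. -/
abbrev stub_sandwichLowerZ2 : Prop := SandwichLowerZ2
/-- Alias of `SandwichUpperZ2` keyed by the registered stub name. -/
abbrev stub_sandwichUpperZ2 : Prop := SandwichUpperZ2
/-- Alias of `CollarModulus` keyed by the registered stub name. -/
abbrev stub_collarModulus : Prop := CollarModulus
/-- Alias of `RoomTransferUpper` keyed by the registered stub name. -/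
abbrev stub_roomTransferUpper : Prop := RoomTransferUpper
/-- Alias of `RoomTransferLower` keyed by the registered stub name. -/
abbrev stub_roomTransferLower : Prop := RoomTransferLower

end __Registered

/-! ### The composition (kernel-checked, no `sorry`) -/

/-- **`LoopsToCrossings` from the five stubs.**  Given `X` and a conformal rectangle `R`: pick a
uniformizing datum `(φ, x)` of `R` (`exists_isUniformizing_holds`); by Smirnov on `𝕋` for `R` it
suffices to prove `bond R δ → F(η)`, `η = crossRatio x`.  Fix `e > 0`, `ε = e/5`, and a modulus `θ`
of uniform continuity of `F` on `[0,1]` for `ε` (Heine–Cantor + `continuousOn_cardyFunction_holds`).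
Tube data `T` exist.  STUB C (both sign patterns, tolerance `θ/2`) gives width bounds `h₀±`; STUBS
D/E give thresholds `h₁±`; put `h̄± := min(h₀±, h₁±, 1/2)`.  STUBS B/A supply widths `h± ≤ h̄±/2`
with the one-lattice sandwiches `bond R ≤ bond C⁺_{h+} + ε`, `bond C⁻_{h−} ≤ bond R + ε`; STUBS D/E
at the pairs `(h±, h̄±)` give `bond C⁺_{h+} ≤ tri C⁺_{h̄+} + ε`, `tri C⁻_{h̄−} ≤ bond C⁻_{h−} + ε`;
Smirnov on `𝕋` for the two collar rectangles `C⁺_{h̄+}`, `C⁻_{h̄−}` (any uniformizing data) and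
STUB C (`|η± − η| ≤ θ/2`) turn these into `|bond R δ − F(η)| < 5ε = e` eventually. -/
theorem LoopsToCrossings_of (hA : __Registered.stub_sandwichLowerZ2)
    (hB : __Registered.stub_sandwichUpperZ2) (hC : __Registered.stub_collarModulus)
    (hD : __Registered.stub_roomTransferUpper) (hE : __Registered.stub_roomTransferLower) :
    Summit.CriticalPhenomena.CardyFormulaZ2.Theses.CardyMagicRigidity.LoopsToCrossings := by
  intro hX R
  -- a uniformizing datum of `R` and Smirnov's theorem on `𝕋` for `R`
  obtain ⟨φ, x, hux⟩ := MarkedDomain.exists_isUniformizing_holds R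
  have htri : Tendsto (triDomainCrossingProb R) (𝓝[>] 0)
      (𝓝 (cardyFunction (crossRatio x))) :=
    hasCrossingLimit_triDomainCrossingProb_holds R φ x hux
  -- it suffices that `bond R δ → F(η)`
  suffices hbond : Tendsto (bondDomainCrossingProb R) (𝓝[>] 0)
      (𝓝 (cardyFunction (crossRatio x))) by
    have key := hbond.sub htri
    simp only [sub_self] at key
    exact key
  rw [Metric.tendsto_nhds]
  intro e he
  -- tolerances
  set ε : ℝ := e / 5 with hε5
  have hε : 0 < ε := by positivity
  have hηI : crossRatio x ∈ Icc (0 : ℝ) 1 :=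
    Ioo_subset_Icc_self (ConformalRectangle.crossRatio_mem_Ioo_of_isUniformizing hux)
  have hcont : ContinuousOn cardyFunction (Icc (0 : ℝ) 1) := continuousOn_cardyFunction_holds
  have hUC : UniformContinuousOn cardyFunction (Icc (0 : ℝ) 1) :=
    isCompact_Icc.uniformContinuousOn_of_continuous hcont
  obtain ⟨θ, hθ, hθF⟩ := Metric.uniformContinuousOn_iff.1 hUC ε hε
  have hθ2 : 0 < θ / 2 := by positivity
  -- tube data of `R` (two-sided Carathéodory charts, proved to exist)
  obtain ⟨T⟩ := JordanDomain.nonempty_tubeData R.toJordanDomain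
  -- modulus-continuity width bounds for the two sign patterns (STUB C)
  obtain ⟨h₀p, hh₀p, hmodp⟩ :=
    hC R T σp (MarkedDomain.abs_le_one_of_sign σp_sign) φ x hux (θ / 2) hθ2
  obtain ⟨h₀m, hh₀m, hmodm⟩ :=
    hC R T σm (MarkedDomain.abs_le_one_of_sign σm_sign) φ x hux (θ / 2) hθ2
  -- thresholds of the two core transfers (STUBS D, E; this is where `X` is used)
  obtain ⟨h₁p, hh₁p, hcoreU⟩ := hD hX R T
  obtain ⟨h₁m, hh₁m, hcoreL⟩ := hE hX R T
  -- the outer levels `h̄±`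
  obtain ⟨hbp, hbp0, hbp1, hbp_h₀, hbp_h₁⟩ :
      ∃ t : ℝ, 0 < t ∧ t ≤ 1 / 2 ∧ t ≤ h₀p ∧ t ≤ h₁p :=
    ⟨min (min h₀p h₁p) (1 / 2), lt_min (lt_min hh₀p hh₁p) (by norm_num), min_le_right _ _,
      (min_le_left _ _).trans (min_le_left _ _), (min_le_left _ _).trans (min_le_right _ _)⟩
  obtain ⟨hbm, hbm0, hbm1, hbm_h₀, hbm_h₁⟩ :
      ∃ t : ℝ, 0 < t ∧ t ≤ 1 / 2 ∧ t ≤ h₀m ∧ t ≤ h₁m :=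
    ⟨min (min h₀m h₁m) (1 / 2), lt_min (lt_min hh₀m hh₁m) (by norm_num), min_le_right _ _,
      (min_le_left _ _).trans (min_le_left _ _), (min_le_left _ _).trans (min_le_right _ _)⟩
  -- the inner levels `h±` and the one-lattice sandwiches (STUBS B, A)
  obtain ⟨hp, hhp, hhp1, hhp_le, hsandU⟩ := hB R T ε hε (hbp / 2) (by positivity)
  obtain ⟨hm, hhm, hhm1, hhm_le, hsandL⟩ := hA R T ε hε (hbm / 2) (by positivity)
  have hp_lt : hp < hbp := by linarith
  have hm_lt : hm < hbm := by linarith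
  -- the two core transfers at the pairs `(h±, h̄±)`
  have hcoreU' := hcoreU hp hbp hhp hbp0 hhp1 hbp1 hp_lt hbp_h₁ ε hε
  have hcoreL' := hcoreL hm hbm hhm hbm0 hhm1 hbm1 hm_lt hbm_h₁ ε hε
  -- Smirnov on `𝕋` for the two outer collar rectangles, and their moduli (STUB C)
  obtain ⟨φp, xp, huxp⟩ := MarkedDomain.exists_isUniformizing_holds
    (R.collarRect T (MarkedDomain.abs_le_one_of_sign σp_sign) hbp0 hbp1)
  obtain ⟨φm, xm, huxm⟩ := MarkedDomain.exists_isUniformizing_holds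
    (R.collarRect T (MarkedDomain.abs_le_one_of_sign σm_sign) hbm0 hbm1)
  have htrip : Tendsto
      (triDomainCrossingProb (R.collarRect T (MarkedDomain.abs_le_one_of_sign σp_sign) hbp0 hbp1))
      (𝓝[>] 0) (𝓝 (cardyFunction (crossRatio xp))) :=
    hasCrossingLimit_triDomainCrossingProb_holds _ φp xp huxp
  have htrim : Tendsto
      (triDomainCrossingProb (R.collarRect T (MarkedDomain.abs_le_one_of_sign σm_sign) hbm0 hbm1))
      (𝓝[>] 0) (𝓝 (cardyFunction (crossRatio xm))) :=
    hasCrossingLimit_triDomainCrossingProb_holds _ φm xm huxm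
  have hxpI : crossRatio xp ∈ Icc (0 : ℝ) 1 :=
    Ioo_subset_Icc_self (ConformalRectangle.crossRatio_mem_Ioo_of_isUniformizing huxp)
  have hxmI : crossRatio xm ∈ Icc (0 : ℝ) 1 :=
    Ioo_subset_Icc_self (ConformalRectangle.crossRatio_mem_Ioo_of_isUniformizing huxm)
  have hηp : |crossRatio xp - crossRatio x| ≤ θ / 2 := hmodp hbp hbp0 hbp1 hbp_h₀ φp xp huxp
  have hηm : |crossRatio xm - crossRatio x| ≤ θ / 2 := hmodm hbm hbm0 hbm1 hbm_h₀ φm xm huxm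
  have hFp : dist (cardyFunction (crossRatio xp)) (cardyFunction (crossRatio x)) < ε :=
    hθF _ hxpI _ hηI (by rw [Real.dist_eq]; linarith)
  have hFm : dist (cardyFunction (crossRatio xm)) (cardyFunction (crossRatio x)) < ε :=
    hθF _ hxmI _ hηI (by rw [Real.dist_eq]; linarith)
  rw [Real.dist_eq, abs_sub_lt_iff] at hFp hFm
  -- eventually the two triangular crossing probabilities are within `ε` of their Cardy values
  have hevp := (Metric.tendsto_nhds.1 htrip) ε hε
  have hevm := (Metric.tendsto_nhds.1 htrim) ε hε
  -- assemble
  filter_upwards [hsandU, hsandL, hcoreU', hcoreL', hevp, hevm] with δ h1 h2 h3 h4 h5 h6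
  rw [Real.dist_eq, abs_sub_lt_iff] at h5 h6 ⊢
  constructor <;> linarith [h5.1, h5.2, h6.1, h6.2, hFp.1, hFp.2, hFm.1, hFm.2]

/-- The crux from the registered stubs (the lead's closing theorem: sorry-free once every `stub_*`
is replaced by its landed helper; its type is literally the route decl). -/
theorem loopsToCrossings_proof :
    Summit.CriticalPhenomena.CardyFormulaZ2.Theses.CardyMagicRigidity.LoopsToCrossings :=
  LoopsToCrossings_of stub_sandwichLowerZ2 stub_sandwichUpperZ2 stub_collarModulus
    stub_roomTransferUpper stub_roomTransferLower

end Summit.CriticalPhenomena.CardyFormulaZ2.Cruxes.LoopsToCrossings.BrSandwichDiagonal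

end

#h21_check_skeleton "stmt-CriticalPhenomena-4837" Summit.CriticalPhenomena.CardyFormulaZ2.Theses.CardyMagicRigidity.LoopsToCrossings stub_sandwichLowerZ2 stub_sandwichUpperZ2 stub_collarModulus stub_roomTransferUpper stub_roomTransferLower
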